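import Literature.AnabelianGeometry.SemiGraphs.TemperedAnabelianMorphisms
import Literature.AnabelianGeometry.SemiGraphs.DOFTypeHomComposition
import Mathlib.CategoryTheory.Equivalence

/-!
# The category `DLoc_{G_K}(Π^temp_{X_K})` with its genuine morphisms ([SemiAnbd] §6, pp. 73–74)

Mochizuki, *Semi-graphs of anabelioids*, Publ. RIMS **42** (2006) [SemiAnbd], §6, author's
manuscript pp. 73–74: "First, we define the category `DLoc_{G_K}(Π^temp_{X_K})` as follows: An
object of this category is a surjection of tempered groups `H ↠ J` where `H ⊆ Π^temp_{X_K}` is an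
open subgroup of finite index; `J` is the quotient of `H` by the closed normal subgroup generated by
some collection of cuspidal geometric decomposition groups; and we assume that `J` is 'hyperbolic'
… Given two objects `Hᵢ ↠ Jᵢ`, where `i = 1, 2`, of this category, a morphism in this category is
defined to be a diagram [`H₁`, `H₂` over `J₁ → J₂`] where the vertical morphisms are the given
morphisms, and the horizontal morphism is an outer homomorphism of DOF-type that is compatible with
the various natural [open] outer homomorphisms from the `Hᵢ`, `Jᵢ` to `G_K`."
[cite: MochizukiSemiAnbd2006, §6 pp.73-74]

## What this file adds (cell abc-iut, layer L3, seat abc-iut-L3-t4; additive to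
`TemperedAnabelianMorphisms.lean`, whose module docstring left "morphisms of `DLoc_{G_K}(Π^temp)`
as outer DOF-type homomorphisms `J₁ → J₂` over `G_K`" as TODO(general form))

Over the FROZEN curve-level interface `TemperedCurve p` and the objects `DLocObj X` of
`TemperedAnabelianMorphisms.lean` (which record `H` and the kernel `N` of `H ↠ J`), this file
DEFINES with Mathlib:

* the tempered group `J = H/N` of an object (`DLocObj.J`, quotient topology), the given surjection
  `H ↠ J` (`DLocObj.proj`) and the natural homomorphism `J → G_K ⊆ G_{ℚ_p}` (`DLocObj.augJ`; it
  exists because `N ⊆ Δ^temp_X = Ker(Π^temp_{X_K} → G_K)`, proved in `DLocObj.N_le_deltaTemp`);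
* representatives of morphisms (`DLocObj.HomRep`: a continuous homomorphism `J₁ → J₂` of DOF-type
  with `(J₂ → G_K) ∘ φ = Inn(g) ∘ (J₁ → G_K)` for some `g ∈ G_K`), the outer-homomorphism relation
  (conjugation by an element of `J₂`), the morphisms `DLocObj.Hom A B` = classes of representatives,
  and the resulting category structure `DLocObj.dlocCategory X` (a `def`, not an instance;
  identities and composites are of DOF-type by `DOFTypeHomComposition.lean`);
* the scheme-theoretic side `DLoc_K(X_K)` with "the tempered fundamental group functor" valued in
  THIS category as interface data (`DLocSchemeData X`; schemes are not in the tree -- TODO-merge: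
  abc-iut-L4-t1), and its repackaging `DLocSchemeData.toDLocContext` as a `DLocContext X` of
  `TemperedAnabelianMorphisms.lean` whose group-theoretic category IS `dlocCategory X`.

Consequently the gen-0 predicates `TemperedCurve.DLocEquivalence X D.toDLocContext` (Thm. 6.8 (i)),
`TemperedCurve.IsoInducesDLocEquivalence X Y DX.toDLocContext DY.toDLocContext α` and
`TemperedCurve.IsoPreservesTemperedDLocType …` (Thm. 6.8 (ii)), `TemperedCurve.IsTemperedDLocType X
D.toDLocContext x` (Def. 6.7) are, at such contexts, the printed statements with their genuine
group-theoretic morphisms; `TemperedMorphismOrigin.DLocGroupTheoreticityGenuineHolds Ω` bundles them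
as printed over the origin hypotheses (nothing asserted).  Still TODO(general form): "functorial,
up to unique isomorphisms of equivalences of categories, with respect to `α`" (Thm. 6.8 (ii)).
No statement of the paper is strengthened; nothing here takes a side on [IUTchIII] Cor. 3.12.
-/

noncomputable section

namespace Literature.AnabelianGeometry.SemiGraphs

open scoped Pointwise
open CategoryTheory Topology

variable {p : ℕ} [Fact p.Prime]

namespace DLocObj

variable {X : TemperedCurve p}

/-! ### The tempered group `J = H/N` of an object and its augmentation to `G_K` -/

/-- The kernel `N` of `H ↠ J`, viewed inside `H` (p. 74: "the closed normal subgroup generated by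
some collection of cuspidal geometric decomposition groups").  Written as the normal closure of
`N ∩ H ⊆ H` — a no-op, `N ∩ H` being normal in `H` (`NH_eq`) — so that Lean sees its normality.
[cite: MochizukiSemiAnbd2006, §6 p.74] -/
abbrev NH (A : DLocObj X) : Subgroup A.H :=
  Subgroup.normalClosure ((A.N.subgroupOf A.H : Subgroup A.H) : Set A.H)

/-- `N ∩ H ⊆ H` is the closure of the normal closure of the generating cuspidal geometric
decomposition groups (the defining equation `N_eq` of the object, pulled back to `H`).
[cite: MochizukiSemiAnbd2006, §6 p.74] -/
theorem subgroupOf_N_eq (A : DLocObj X) : A.N.subgroupOf A.H =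
    (Subgroup.normalClosure
      (⋃ I ∈ A.gens, ((I.subgroupOf A.H : Subgroup A.H) : Set A.H))).topologicalClosure := by
  rw [Subgroup.subgroupOf, A.N_eq,
    Subgroup.comap_map_eq_self_of_injective (Subgroup.subtype_injective A.H)]

/-- `N ∩ H` is normal in `H`. [cite: MochizukiSemiAnbd2006, §6 p.74] -/
theorem normal_subgroupOf_N (A : DLocObj X) : (A.N.subgroupOf A.H).Normal := by
  rw [subgroupOf_N_eq]
  exact Subgroup.is_normal_topologicalClosure _

/-- `NH` is `N ∩ H ⊆ H` (the normal closure in its definition is a no-op).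
[cite: MochizukiSemiAnbd2006, §6 p.74] -/
theorem NH_eq (A : DLocObj X) : A.NH = A.N.subgroupOf A.H := by
  haveI := A.normal_subgroupOf_N
  exact Subgroup.normalClosure_eq_self _

/-- `N ⊆ H` is closed in `H` (p. 74: "closed normal subgroup"). [cite: MochizukiSemiAnbd2006, §6 p.74] -/
theorem isClosed_NH (A : DLocObj X) : IsClosed (A.NH : Set A.H) := by
  rw [NH_eq, subgroupOf_N_eq]
  exact Subgroup.isClosed_topologicalClosure _

/-- `N ⊆ H`. [cite: MochizukiSemiAnbd2006, §6 p.74] -/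
theorem N_le_H (A : DLocObj X) : A.N ≤ A.H := by
  rw [A.N_eq]
  exact Subgroup.map_subtype_le _

/-- `N ⊆ Δ^temp_X`: the generators are subgroups of cuspidal geometric decomposition groups
`I_x ⊆ Δ^temp_X` (p. 71) and `Δ^temp_X = Ker(Π^temp_{X_K} → G_K)` is a closed normal subgroup.
[cite: MochizukiSemiAnbd2006, §6 pp.71, 74] -/
theorem N_le_deltaTemp (A : DLocObj X) : A.N ≤ X.DeltaTemp := by
  suffices h : A.N.subgroupOf A.H ≤ X.DeltaTemp.subgroupOf A.H by
    intro x hx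
    have hx' : (⟨x, A.N_le_H hx⟩ : A.H) ∈ A.N.subgroupOf A.H := Subgroup.mem_subgroupOf.2 hx
    exact Subgroup.mem_subgroupOf.1 (h hx')
  haveI : X.DeltaTemp.Normal := by unfold TemperedCurve.DeltaTemp; infer_instance
  rw [subgroupOf_N_eq]
  refine Subgroup.topologicalClosure_minimal _ (Subgroup.normalClosure_le_normal ?_) ?_
  · intro y hy
    simp only [Set.mem_iUnion] at hy
    obtain ⟨I, hI, hyI⟩ := hy
    obtain ⟨I₀, ⟨x, -, γ, rfl⟩, rfl⟩ := A.gens_cuspidal I hI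
    have hy' : (y : X.PiTemp) ∈ γ • X.inertia x :=
      (Subgroup.mem_inf.1 (Subgroup.mem_subgroupOf.1 hyI)).2
    refine Subgroup.mem_subgroupOf.2 ?_
    obtain ⟨w, hw, hwy⟩ := (Subgroup.mem_smul_pointwise_iff_exists _ _ _).1 hy'
    rw [← hwy, ConjAct.smul_def]
    exact Subgroup.Normal.conj_mem inferInstance w (Subgroup.mem_inf.1 hw).2 _
  · have h1 : IsClosed ((X.DeltaTemp : Subgroup X.PiTemp) : Set X.PiTemp) :=
      isClosed_singleton.preimage X.aug.continuous
    exact h1.preimage continuous_subtype_val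

/-- The tempered group `J = H/N` of an object `H ↠ J` of `DLoc_{G_K}(Π^temp_{X_K})` (p. 74), with
the quotient topology. [cite: MochizukiSemiAnbd2006, §6 p.74] -/
abbrev J (A : DLocObj X) : Type := A.H ⧸ A.NH

/-- The given surjection `H ↠ J` of an object (p. 74). [cite: MochizukiSemiAnbd2006, §6 p.74] -/
def proj (A : DLocObj X) : A.H →ₜ* A.J :=
  ⟨QuotientGroup.mk' A.NH, QuotientGroup.continuous_mk⟩

/-- The natural [open] homomorphism `J → G_K ⊆ G_{ℚ_p}` of an object (p. 74: "the various natural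
[open] outer homomorphisms from the `Hᵢ`, `Jᵢ` to `G_K`"): the restriction of the augmentation
`Π^temp_{X_K} → G_K` to `H` kills `N ⊆ Δ^temp_X`. [cite: MochizukiSemiAnbd2006, §6 p.74] -/
def augJ (A : DLocObj X) : A.J →ₜ* GQp p where
  toMonoidHom := QuotientGroup.lift A.NH (X.aug.toMonoidHom.comp A.H.subtype) (by
    rw [NH_eq]
    intro y hy
    exact (MonoidHom.mem_ker).2 ((MonoidHom.mem_ker).1
      (A.N_le_deltaTemp (Subgroup.mem_subgroupOf.1 hy))))
  continuous_toFun := by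
    refine (QuotientGroup.isQuotientMap_mk A.NH).continuous_iff.2 ?_
    exact X.aug.continuous.comp continuous_subtype_val

/-- `augJ ∘ proj = aug|_H`. [cite: MochizukiSemiAnbd2006, §6 p.74] -/
theorem augJ_proj (A : DLocObj X) (h : A.H) : A.augJ (A.proj h) = X.aug h := rfl

/-! ### Morphisms: outer homomorphisms of DOF-type over `G_K` -/

/-- A representative of a morphism `(H₁ ↠ J₁) → (H₂ ↠ J₂)` of `DLoc_{G_K}(Π^temp_{X_K})` (p. 74):
a continuous homomorphism `φ : J₁ → J₂` "of DOF-type that is compatible with the various natural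
[open] outer homomorphisms … to `G_K`", i.e. `(J₂ → G_K) ∘ φ` and `J₁ → G_K` agree up to an inner
automorphism of `G_K`. [cite: MochizukiSemiAnbd2006, §6 p.74] -/
structure HomRep (A B : DLocObj X) : Type where
  /-- a continuous homomorphism `J₁ → J₂` representing the outer homomorphism -/
  toHom : A.J →ₜ* B.J
  /-- "of DOF-type" (Def. 6.2 (iii)) -/
  isDOFTypeHom : IsDOFTypeHom toHom
  /-- "compatible with the natural outer homomorphisms to `G_K`" -/
  compat : ∃ g ∈ X.GK, ∀ j : A.J, B.augJ (toHom j) = g * A.augJ j * g⁻¹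

namespace HomRep

variable {A B C : DLocObj X}

/-- Two representatives define the same OUTER homomorphism iff they differ by an inner automorphism
of `J₂` (p. 74: "outer homomorphism"; §0: homomorphisms considered up to composition with an inner
automorphism). [cite: MochizukiSemiAnbd2006, §6 p.74] -/
def setoid (A B : DLocObj X) : Setoid (HomRep A B) where
  r φ ψ := ∃ b : B.J, ∀ j, ψ.toHom j = b * φ.toHom j * b⁻¹
  iseqv :=
    ⟨fun φ => ⟨1, fun j => by simp⟩,
      fun {φ ψ} h => by
        obtain ⟨b, hb⟩ := h
        exact ⟨b⁻¹, fun j => by rw [hb j]; group⟩,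
      fun {φ ψ χ} h h' => by
        obtain ⟨b, hb⟩ := h
        obtain ⟨c, hc⟩ := h'
        exact ⟨c * b, fun j => by rw [hc j, hb j]; group⟩⟩

/-- The identity representative. [cite: MochizukiSemiAnbd2006, §6 p.74] -/
protected def id (A : DLocObj X) : HomRep A A :=
  ⟨ContinuousMonoidHom.id A.J, isDOFTypeHom_id, ⟨1, X.GK.one_mem, fun j => by simp⟩⟩

/-- Composition of representatives (DOF-type is preserved: `IsDOFTypeHom.comp`; the compatibility
elements of `G_K` multiply). [cite: MochizukiSemiAnbd2006, §6 p.74] -/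
protected def comp (ψ : HomRep B C) (φ : HomRep A B) : HomRep A C :=
  ⟨ψ.toHom.comp φ.toHom, ψ.isDOFTypeHom.comp φ.isDOFTypeHom, by
    obtain ⟨g, hg, hφ⟩ := φ.compat
    obtain ⟨g', hg', hψ⟩ := ψ.compat
    refine ⟨g' * g, X.GK.mul_mem hg' hg, fun j => ?_⟩
    change C.augJ (ψ.toHom (φ.toHom j)) = _
    rw [hψ, hφ]
    group⟩

/-- Composition respects the outer-homomorphism relation.
[cite: MochizukiSemiAnbd2006, §6 p.74] -/
theorem comp_rel {ψ ψ' : HomRep B C} {φ φ' : HomRep A B} (hψ : (setoid B C).r ψ ψ')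
    (hφ : (setoid A B).r φ φ') : (setoid A C).r (ψ.comp φ) (ψ'.comp φ') := by
  obtain ⟨c, hc⟩ := hψ
  obtain ⟨b, hb⟩ := hφ
  refine ⟨c * ψ.toHom b, fun j => ?_⟩
  change ψ'.toHom (φ'.toHom j) = _ * ψ.toHom (φ.toHom j) * _
  rw [hb j, hc, map_mul, map_mul, map_inv]
  group

end HomRep

/-- The morphisms `(H₁ ↠ J₁) → (H₂ ↠ J₂)` of `DLoc_{G_K}(Π^temp_{X_K})` (p. 74): OUTER homomorphisms
`J₁ → J₂` of DOF-type compatible with the outer homomorphisms to `G_K` — classes of representatives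
modulo inner automorphisms of `J₂`. [cite: MochizukiSemiAnbd2006, §6 p.74] -/
def Hom (A B : DLocObj X) : Type := Quotient (HomRep.setoid A B)

/-- **The category `DLoc_{G_K}(Π^temp_{X_K})`** ([SemiAnbd] pp. 73–74) on the objects `DLocObj X`,
with the genuine morphisms `DLocObj.Hom` (a definition, not an instance: use
`letI := DLocObj.dlocCategory X`). [cite: MochizukiSemiAnbd2006, §6 pp.73-74] -/
@[reducible] def dlocCategory (X : TemperedCurve p) : Category.{0} (DLocObj X) where
  Hom A B := Hom A B
  id A := Quotient.mk _ (HomRep.id A)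
  comp f g := Quotient.map₂ (fun φ ψ => HomRep.comp ψ φ)
    (fun _ _ hφ _ _ hψ => HomRep.comp_rel hψ hφ) f g
  id_comp := by
    rintro A B ⟨φ⟩
    exact Quotient.sound ⟨1, fun j => by simp [HomRep.comp, HomRep.id]⟩
  comp_id := by
    rintro A B ⟨φ⟩
    exact Quotient.sound ⟨1, fun j => by simp [HomRep.comp, HomRep.id]⟩
  assoc := by
    rintro A B C D ⟨φ⟩ ⟨ψ⟩ ⟨χ⟩
    exact Quotient.sound ⟨1, fun j => by simp [HomRep.comp]⟩

/-- The class of a representative, as a morphism of `dlocCategory X`.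
[cite: MochizukiSemiAnbd2006, §6 p.74] -/
def homMk {A B : DLocObj X} (φ : HomRep A B) :
    letI := dlocCategory X; A ⟶ B :=
  Quotient.mk _ φ

namespace HomRep

/-- The representative given by an isomorphism of tempered groups `e : J₁ ⥲ J₂` lying over `G_K`
(`(J₂ → G_K) ∘ e = (J₁ → G_K)`): of DOF-type (a surjection), compatible with `g = 1`.
[cite: MochizukiSemiAnbd2006, §6 p.74] -/
def ofEquiv {A B : DLocObj X} (e : A.J ≃ₜ* B.J) (he : ∀ j, B.augJ (e j) = A.augJ j) :
    HomRep A B :=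
  ⟨(e : A.J →ₜ* B.J), isDOFTypeHom_of_surjective _ e.surjective,
    ⟨1, X.GK.one_mem, fun j => by simp [he]⟩⟩

/-- The underlying map of `ofEquiv e he` is `e`. [cite: MochizukiSemiAnbd2006, §6 p.74] -/
@[simp] theorem ofEquiv_toHom_apply {A B : DLocObj X} (e : A.J ≃ₜ* B.J)
    (he : ∀ j, B.augJ (e j) = A.augJ j) (j : A.J) : (ofEquiv e he).toHom j = e j := rfl

end HomRep

/-- The isomorphism of `dlocCategory X` defined by an isomorphism of tempered groups `J₁ ⥲ J₂`
over `G_K`. [cite: MochizukiSemiAnbd2006, §6 p.74] -/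
def isoOfEquiv {A B : DLocObj X} (e : A.J ≃ₜ* B.J) (he : ∀ j, B.augJ (e j) = A.augJ j) :
    letI := dlocCategory X; A ≅ B :=
  letI := dlocCategory X
  { hom := homMk (HomRep.ofEquiv e he)
    inv := homMk (HomRep.ofEquiv e.symm fun j => by rw [← he (e.symm j), e.apply_symm_apply])
    hom_inv_id := Quotient.sound ⟨1, fun j => by simp [HomRep.comp, HomRep.id]⟩
    inv_hom_id := Quotient.sound ⟨1, fun j => by simp [HomRep.comp, HomRep.id]⟩ }

end DLocObj

/-! ### The scheme-theoretic side with the tempered fundamental group functor valued in `dlocCategory` -/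

/-- The scheme-theoretic side of Theorem 6.8 for `X_K` as interface data, refining
`DLocContext X` of `TemperedAnabelianMorphisms.lean`: the category `DLoc_K(X_K)` ([Mzk8] §2: objects
the hyperbolic partial compactifications `Y ↪ Z` of finite étale coverings `Y → X_K` with
`K`-structure, morphisms the dominant `K`-morphisms `Z → Z'`), the object `X_K` itself, the tempered
datum of each object and the homomorphism induced by each morphism, and "the tempered fundamental
group functor" `DLoc_K(X_K) → DLoc_{G_K}(Π^temp_{X_K})` (Thm. 6.8 (i), p. 74) VALUED IN THE GENUINE
CATEGORY `DLocObj.dlocCategory X` — `Y ↪ Z ↦ (Π^temp_Y ↠ Π^temp_Z)` with `Π^temp_Y ⊆ Π^temp_{X_K}`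
open of finite index and `Π^temp_Z` its quotient by the cuspidal geometric decomposition groups of
the cusps of `Y` filled in `Z` — together with the identifications `J_Z ≅ Π^temp_Z` relating the two
descriptions.  INTERFACE BOUNDARY: schemes, `DLoc_K(X_K)` and `π₁^temp` are not in the tree
-- TODO-merge: abc-iut-L4-t1, abc-iut-L3-t2. [cite: MochizukiSemiAnbd2006, §6 pp.73-74] -/
structure DLocSchemeData (X : TemperedCurve p) : Type 2 where
  /-- the category `DLoc_K(X_K)` -/
  DLocK : Type 1
  [catK : Category.{0} DLocK]
  /-- the object `X_K` (trivial partial compactification of the trivial covering) -/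
  self : DLocK
  /-- the tempered datum of the hyperbolic curve `Z` underlying an object `Y ↪ Z` -/
  curve : DLocK → TemperedCurve p
  /-- the homomorphism `Π^temp_Z → Π^temp_{Z'}` induced by a morphism `Z → Z'` (a representative of
  the induced outer homomorphism) -/
  pi1 : ∀ {Z Z' : DLocK}, (Z ⟶ Z') → ((curve Z).PiTemp →ₜ* (curve Z').PiTemp)
  /-- the identification of `Π^temp` of the object `X_K` with `Π^temp_{X_K}` -/
  selfIso : (curve self).PiTemp ≃ₜ* X.PiTemp
  /-- "the tempered fundamental group functor" `DLoc_K(X_K) → DLoc_{G_K}(Π^temp_{X_K})`,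
  `(Y ↪ Z) ↦ (Π^temp_Y ↠ Π^temp_Z)` (p. 74), valued in the genuine category -/
  pi1Functor : letI := DLocObj.dlocCategory X; DLocK ⥤ DLocObj X
  /-- `X_K ↦ (Π^temp_{X_K} ↠ Π^temp_{X_K})`: `H = Π^temp_{X_K}` … -/
  pi1Functor_self_H : letI := DLocObj.dlocCategory X; (pi1Functor.obj self).H = ⊤
  /-- … and no cusp is filled in -/
  pi1Functor_self_gens : letI := DLocObj.dlocCategory X; (pi1Functor.obj self).gens = ∅
  /-- `J_Z ≅ Π^temp_Z` for every object `Y ↪ Z` -/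
  objIso : letI := DLocObj.dlocCategory X; ∀ Z : DLocK, (pi1Functor.obj Z).J ≃ₜ* (curve Z).PiTemp
  /-- on morphisms the functor is the outer homomorphism induced by `π₁^temp`: some representative
  of `pi1Functor.map f` agrees with `pi1 f` under the identifications, up to an inner automorphism -/
  map_objIso : letI := DLocObj.dlocCategory X; ∀ {Z Z' : DLocK} (f : Z ⟶ Z'),
    ∃ φ : DLocObj.HomRep (pi1Functor.obj Z) (pi1Functor.obj Z'),
      pi1Functor.map f = DLocObj.homMk φ ∧
        ∃ c : (curve Z').PiTemp, ∀ j, objIso Z' (φ.toHom j) = c * pi1 f (objIso Z j) * c⁻¹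
  /-- for `X_K` itself the identifications compose to the inclusion `H = Π^temp_{X_K} ⊆ Π^temp_{X_K}` -/
  selfIso_objIso : letI := DLocObj.dlocCategory X; ∀ h : (pi1Functor.obj self).H,
    selfIso (objIso self ((pi1Functor.obj self).proj h)) = (h : X.PiTemp)

namespace DLocSchemeData

variable {X : TemperedCurve p}

/-- Repackaging as a `DLocContext X` (`TemperedAnabelianMorphisms.lean`) whose group-theoretic
category `DLoc_{G_K}(Π^temp_{X_K})` IS the genuine `DLocObj.dlocCategory X`.  Hence, for
`D : DLocSchemeData X`, the predicates `TemperedCurve.DLocEquivalence X D.toDLocContext` (Thm. 6.8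
(i)), `TemperedCurve.IsoInducesDLocEquivalence` / `TemperedCurve.IsoPreservesTemperedDLocType` at
`D.toDLocContext` (Thm. 6.8 (ii)) and `TemperedCurve.IsTemperedDLocType X D.toDLocContext` (Def. 6.7)
are the printed statements with genuine morphisms. [cite: MochizukiSemiAnbd2006, §6 pp.73-74] -/
def toDLocContext (D : DLocSchemeData X) : DLocContext X :=
  letI := D.catK
  { DLocK := D.DLocK
    self := D.self
    curve := D.curve
    pi1 := D.pi1
    selfIso := D.selfIso
    catG := DLocObj.dlocCategory X
    pi1Functor := D.pi1Functor }

/-- The group-theoretic category of `D.toDLocContext` is `DLocObj.dlocCategory X` (by construction).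
[cite: MochizukiSemiAnbd2006, §6 pp.73-74] -/
theorem toDLocContext_catG (D : DLocSchemeData X) :
    D.toDLocContext.catG = DLocObj.dlocCategory X := rfl

end DLocSchemeData

/-! ### The printed statements over the origin hypotheses, genuine-morphism form -/

namespace TemperedMorphismOrigin

/-- **[SemiAnbd] Theorem 6.8 (i), (ii)** (p. 74) as printed, with the GENUINE morphisms of
`DLoc_{G_K}(Π^temp_{X_K})`: for all hyperbolic curves `X_K`, `Y_L` over finite extensions of `ℚ_p`
with their genuine `DLoc_K` data (certified through `toDLocContext`) and every isomorphism of
tempered groups `α`: `DLoc_K(X_K) ⥲ DLoc_{G_K}(Π^temp_{X_K})` is an equivalence; `α` induces an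
equivalence `DLoc_{G_K}(Π^temp_{X_K}) ⥲ DLoc_{G_L}(Π^temp_{Y_L})` transporting `(H, N)` along `α`;
`α` preserves the decomposition groups of tempered `DLoc`-type (asserted only for certified data).
The specialisation of `DLocGroupTheoreticityHolds` to genuine-morphism contexts
(`dlocGroupTheoreticityGenuineHolds_of`). [cite: MochizukiSemiAnbd2006, Thm 6.8(i)-(ii) p.74] -/
def DLocGroupTheoreticityGenuineHolds (Ω : TemperedMorphismOrigin p) : Prop :=
  ∀ (X Y : TemperedCurve p) (DX : DLocSchemeData X) (DY : DLocSchemeData Y),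
    Ω.IsHyperbolicCurveOrigin X → Ω.IsHyperbolicCurveOrigin Y →
    Ω.IsDLocOrigin DX.toDLocContext → Ω.IsDLocOrigin DY.toDLocContext →
    X.DLocEquivalence DX.toDLocContext ∧ ∀ α : X.PiTemp ≃ₜ* Y.PiTemp,
      X.IsoInducesDLocEquivalence Y DX.toDLocContext DY.toDLocContext α ∧
        X.IsoPreservesTemperedDLocType Y DX.toDLocContext DY.toDLocContext α

/-- The genuine-morphism form is the specialisation of `DLocGroupTheoreticityHolds`.
[cite: MochizukiSemiAnbd2006, Thm 6.8(i)-(ii) p.74] -/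
theorem dlocGroupTheoreticityGenuineHolds_of (Ω : TemperedMorphismOrigin p)
    (h : Ω.DLocGroupTheoreticityHolds) : Ω.DLocGroupTheoreticityGenuineHolds :=
  fun X Y DX DY hX hY hDX hDY => h X Y DX.toDLocContext DY.toDLocContext hX hY hDX hDY

end TemperedMorphismOrigin


end Literature.AnabelianGeometry.SemiGraphs

end
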